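import Literature.NumberTheory.GaloisCohomology.Howard2004.SelmerAtPresentationProofs
import Literature.NumberTheory.GaloisCohomology.Howard2004.GnTensorIdentificationProofs
import Literature.NumberTheory.GaloisCohomology.Howard2004.KolyvaginRelationLocalizationProofs
import Literature.NumberTheory.GaloisCohomology.Howard2004.DVRKolyvaginBound
import HarnessLib

/-!
# Howard 2004, Lemma 1.6.4 on a `DVRSetting`: the Kolyvagin classes READ ON `H¹_{F(n)}(K, T^{(k)})`
# (the ENGINE datum `κ k n`) — de-tensored by the pins' generators and pulled back along `T^{(k)} ↠ T^{(k)}/I_n`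
# (one definition with body + its characterisation)

B. Howard, *The Heegner point Kolyvagin system*, Compositio Math. **140** (2004) (arXiv:1202.6340), proof of
Lemma 1.6.4 (arXiv p. 11 L88–90): «We also fix a generator for the cyclic group `G_ℓ` for every `ℓ` so that we may
identify `H¹_{F(n)}(K, T^{(k)}) ⊗ G_n ≅ H¹_{F(n)}(K, T^{(k)})`».  The tree records `κ^{(k)}_n` as an element of
`H¹_{F(n)}(K, T^{(k)}/I_nT^{(k)}) ⊗ G_n` (`DVRSetting.KolyvaginSystem.κ`, Def. 1.2.3); for `n ∈ 𝓝(𝓛^{(k)})` the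
ideal `I_n` kills `T^{(k)}` so `π_n : T^{(k)} → T^{(k)}/I_n` has trivial kernel and `H¹(π_n)` identifies the
`F(n)`-Selmer classes of `T^{(k)}` with `H¹_{F(n)}(K, T^{(k)}/I_n)` (PRES, `SelmerAtPresentationProofs`), while
`a ↦ a ⊗ γ_n` is a bijection for generators `γ_ℓ` (GN-ID, `GnTensorIdentificationProofs`).  L164-DATA part 2
(cell `pub/bsd-print-x9`, LEAD g12 ruling 2026-08-29):

* **`DVRSetting.kappaR S κ pins k n : H¹(K, T^{(k)})`** — THE class `c` with `c ∈ H¹_{F(n)}(K, T^{(k)})` and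
  `κ^{(k)}_n = H¹(π_n)(c) ⊗ γ_n`, `γ_ℓ = ḡ_ℓ` the generator of the tame pin at `ℓ` (`TamePin.gbar`); defined by
  choice when `ker π_n = 0` and `n ∈ 𝓝(𝓛)` (junk `0` otherwise);
* `kappaR_mem_selmerGroup`, **`map_subtype_κ_eq_kappaR_tmul`** (the defining identity),
  **`eq_kappaR_of_tmul_eq`** (uniqueness), `kappaR_eq_zero_iff` («`κ^{(k)}_n = 0 ↔ c = 0`»).

One definition with body + theorems: no named fact, no instance, no notation, no `sorry`.  The engine's `H k n`
(`DVRSettingEngineData.selmerModuleAt`) has this `c` as its element `κ k n` (membership = `kappaR_mem_selmerGroup`).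
`thm161_dvrKolyvaginBound` is NOT proved; BSD is not proved by any of this.
-/

set_option autoImplicit false

noncomputable section

open Function NumberField IsDedekindDomain Field
open scoped NumberField ContRepresentation Classical TensorProduct

namespace Literature.NumberTheory.GaloisCohomology.Howard2004

open Literature.NumberTheory.GaloisRepresentations
open Literature.NumberTheory.GaloisRepresentations.DiscreteGaloisModule

namespace DVRSetting

variable {p : ℕ} [Fact p.Prime] {K : Type} [Field K] [NumberField K]
  {R : Type} [CommRing R] [IsDomain R] [IsDiscreteValuationRing R] [Algebra ℤ_[p] R]
  {N : ℕ → Type} [∀ k, AddCommGroup (N k)] [∀ k, TopologicalSpace (N k)]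
  [∀ k, DiscreteTopology (N k)] [∀ k, Module R (N k)]
  {Rk : ℕ → Type} [∀ k, CommRing (Rk k)] [∀ k, IsLocalRing (Rk k)] [∀ k, TopologicalSpace (Rk k)]
  [∀ k, DiscreteTopology (Rk k)] [∀ k, Algebra ℤ_[p] (Rk k)] [∀ k, Algebra R (Rk k)]
  [∀ k, Module (Rk k) (N k)] [∀ k, IsScalarTower R (Rk k) (N k)]
  {Nbar : Type} [AddCommGroup Nbar] [TopologicalSpace Nbar] [DiscreteTopology Nbar]
  [∀ k, Module (Rk k) Nbar]
  {Nq : ℕ → Finset (HeightOneSpectrum (𝓞 K)) → Type} [∀ k n, AddCommGroup (Nq k n)]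
  [∀ k n, TopologicalSpace (Nq k n)] [∀ k n, DiscreteTopology (Nq k n)]
  [∀ k n, Module (Rk k) (Nq k n)] [∀ k n, Module R (Nq k n)]
  [∀ k n, IsScalarTower R (Rk k) (Nq k n)]

/-- The generators `γ_ℓ = ḡ_ℓ ∈ G_ℓ` of a pin family generate. [cite: Howard2004HeegnerKolyvagin, Def. 1.2.1 and Lemma 1.6.4 (arXiv p. 6 L69–72, p. 11 L88–90)] -/
theorem gbar_generates (pins : ∀ v : HeightOneSpectrum (𝓞 K), TamePin v) (n : Finset (HeightOneSpectrum (𝓞 K))) :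
    ∀ v ∈ n, ∀ x : Gell v, x ∈ AddSubgroup.zmultiples (pins v).gbar :=
  fun v _ x => (pins v).mem_zmultiples_gbar x

/-- **The Kolyvagin class `κ^{(k)}_n` read on `H¹(K, T^{(k)})`** (Howard's identification
`H¹_{F(n)}(K,T^{(k)}) ⊗ G_n ≅ H¹_{F(n)}(K,T^{(k)})` by the generators `ḡ_ℓ` of the pins, composed with the pull-back
along `H¹(π_n)`, bijective on Selmer classes when `ker π_n = 0`): the unique `c ∈ H¹_{F(n)}(K, T^{(k)})` with
`κ^{(k)}_n = H¹(π_n)(c) ⊗ γ_n`; `0` off the levels where this makes sense.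
[cite: Howard2004HeegnerKolyvagin, Def. 1.2.3 and Lemma 1.6.4 (arXiv p. 7 L1–12, p. 11 L88–90)] -/
def kappaR (S : DVRSetting p K R N Rk Nbar Nq) (κ : S.KolyvaginSystem)
    (pins : ∀ v : HeightOneSpectrum (𝓞 K), TamePin v) (k : ℕ) (n : Finset (HeightOneSpectrum (𝓞 K))) :
    galoisCohomology (S.T.ρ k) 1 :=
  if h : LinearMap.ker ((S.LD k).π n) = ⊥ ∧ n ∈ (S.t k).levelSet then
    Classical.choose ((S.LD k).exists_unique_mem_selmerGroup_atLevel_eq S.jbar n h.1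
      (Classical.choose (exists_unique_eq_tmul_tprod (fun v => (pins v).gbar) n (gbar_generates pins n)
        (fun _ hv a => (S.LD k).natCard_gell_smul_selmerAt_eq_zero S.jbar h.2 hv a) (κ.κ k n))))
  else 0

section Spec

variable (S : DVRSetting p K R N Rk Nbar Nq) (κ : S.KolyvaginSystem)
  (pins : ∀ v : HeightOneSpectrum (𝓞 K), TamePin v) (k : ℕ) {n : Finset (HeightOneSpectrum (𝓞 K))}
  (hker : LinearMap.ker ((S.LD k).π n) = ⊥) (hn : n ∈ (S.t k).levelSet)

/-- `κ^{(k)}_n = s ⊗ γ_n` for the de-tensored class `s` (GN-ID). [cite: Howard2004HeegnerKolyvagin, Lemma 1.6.4 (arXiv p. 11 L88–90)] -/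
private theorem kappa_eq_detensor_tmul :
    κ.κ k n = Classical.choose (exists_unique_eq_tmul_tprod (fun v => (pins v).gbar) n (gbar_generates pins n)
        (fun _ hv a => (S.LD k).natCard_gell_smul_selmerAt_eq_zero S.jbar hn hv a) (κ.κ k n)) ⊗ₜ[ℤ]
      (PiTensorProduct.tprod ℤ fun q : ↥n => (pins q).gbar : Gn (K := K) n) :=
  (Classical.choose_spec (exists_unique_eq_tmul_tprod (fun v => (pins v).gbar) n (gbar_generates pins n)
    (fun _ hv a => (S.LD k).natCard_gell_smul_selmerAt_eq_zero S.jbar hn hv a) (κ.κ k n))).1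

include hker hn in
/-- **`κ k n` is an `F(n)`-Selmer class of `T^{(k)}`.** [cite: Howard2004HeegnerKolyvagin, Def. 1.2.3 and Lemma 1.6.4 (arXiv p. 7 L1–12, p. 11 L88–90)] -/
theorem kappaR_mem_selmerGroup : S.kappaR κ pins k n ∈ (((S.t k).atLevel S.jbar n).cond).selmerGroup := by
  rw [kappaR, dif_pos ⟨hker, hn⟩]
  exact (Classical.choose_spec ((S.LD k).exists_unique_mem_selmerGroup_atLevel_eq S.jbar n hker _)).1.1

include hker hn in
/-- **The defining identity: `κ^{(k)}_n = H¹(π_n)(κ k n) ⊗ γ_n`** (read in `H¹(K, T^{(k)}/I_n) ⊗ G_n`).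
[cite: Howard2004HeegnerKolyvagin, Def. 1.2.3 and Lemma 1.6.4 (arXiv p. 7 L1–12, p. 11 L88–90)] -/
theorem map_subtype_κ_eq_kappaR_tmul :
    TensorProduct.map ((S.LD k).selmerAt S.jbar n).subtype.toIntLinearMap LinearMap.id (κ.κ k n) =
      ((S.LD k).isQuotientBy n).cohomologyMap 1 (S.kappaR κ pins k n) ⊗ₜ[ℤ]
        (PiTensorProduct.tprod ℤ fun q : ↥n => (pins q).gbar : Gn (K := K) n) := by
  rw [kappaR, dif_pos ⟨hker, hn⟩]
  have h2 := (Classical.choose_spec ((S.LD k).exists_unique_mem_selmerGroup_atLevel_eq S.jbar n hker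
    (Classical.choose (exists_unique_eq_tmul_tprod (fun v => (pins v).gbar) n (gbar_generates pins n)
      (fun _ hv a => (S.LD k).natCard_gell_smul_selmerAt_eq_zero S.jbar hn hv a) (κ.κ k n))))).1.2
  rw [h2]
  conv_lhs => rw [S.kappa_eq_detensor_tmul κ pins k hn]
  rfl

include hker hn in
/-- **Uniqueness**: an `F(n)`-Selmer class `x` of `T^{(k)}` with `κ^{(k)}_n = H¹(π_n)(x) ⊗ γ_n` is `κ k n`.
[cite: Howard2004HeegnerKolyvagin, Def. 1.2.3 and Lemma 1.6.4 (arXiv p. 7 L1–12, p. 11 L88–90)] -/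
theorem eq_kappaR_of_tmul_eq {x : galoisCohomology (S.T.ρ k) 1}
    (h : TensorProduct.map ((S.LD k).selmerAt S.jbar n).subtype.toIntLinearMap LinearMap.id (κ.κ k n) =
      ((S.LD k).isQuotientBy n).cohomologyMap 1 x ⊗ₜ[ℤ]
        (PiTensorProduct.tprod ℤ fun q : ↥n => (pins q).gbar : Gn (K := K) n)) :
    x = S.kappaR κ pins k n := by
  have h1 := S.map_subtype_κ_eq_kappaR_tmul κ pins k hker hn
  rw [h] at h1
  have hA : ∀ v ∈ n, ∀ a : galoisCohomology ((S.LD k).ρq n) 1, Nat.card (Gell v) • a = 0 :=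
    fun _ hv a => (S.LD k).natCard_gell_smul_galoisCohomology_eq_zero hn hv a
  have hinj := (tmulRight_tprod_bijective (fun v => (pins v).gbar) n (gbar_generates pins n) hA).1 h1
  exact ((S.LD k).isQuotientBy n).bijective_cohomologyMap_of_ker_eq_bot hker |>.1 hinj

include hker hn in
/-- **`κ^{(k)}_n = 0 ↔ κ k n = 0`** (both identifications are bijections).
[cite: Howard2004HeegnerKolyvagin, Lemma 1.6.4 proof (arXiv p. 12 L2: «If `κ^{(k)}(n) ≠ 0` …»)] -/
theorem κ_eq_zero_iff_kappaR_eq_zero : κ.κ k n = 0 ↔ S.kappaR κ pins k n = 0 := by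
  have hA : ∀ v ∈ n, ∀ a : galoisCohomology ((S.LD k).ρq n) 1, Nat.card (Gell v) • a = 0 :=
    fun _ hv a => (S.LD k).natCard_gell_smul_galoisCohomology_eq_zero hn hv a
  have hsub : Function.Injective (TensorProduct.map ((S.LD k).selmerAt S.jbar n).subtype.toIntLinearMap
      (LinearMap.id : Gn (K := K) n →ₗ[ℤ] Gn (K := K) n)) := by
    intro a b hab
    obtain ⟨a', rfl⟩ := (tmulRight_tprod_bijective (fun v => (pins v).gbar) n (gbar_generates pins n)
      (fun _ hv s => (S.LD k).natCard_gell_smul_selmerAt_eq_zero S.jbar hn hv s)).2 a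
    obtain ⟨b', rfl⟩ := (tmulRight_tprod_bijective (fun v => (pins v).gbar) n (gbar_generates pins n)
      (fun _ hv s => (S.LD k).natCard_gell_smul_selmerAt_eq_zero S.jbar hn hv s)).2 b
    simp only [TensorProduct.map_tmul, LinearMap.id_apply] at hab
    have := (tmulRight_tprod_bijective (fun v => (pins v).gbar) n (gbar_generates pins n) hA).1 hab
    rw [show a' = b' from Subtype.ext this]
  constructor
  · intro h0
    have h1 := S.map_subtype_κ_eq_kappaR_tmul κ pins k hker hn
    rw [h0, map_zero] at h1
    have h2 : ((S.LD k).isQuotientBy n).cohomologyMap 1 (S.kappaR κ pins k n) = 0 :=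
      ((tmulRight_tprod_bijective (fun v => (pins v).gbar) n (gbar_generates pins n) hA).1
        (h1.symm.trans (TensorProduct.zero_tmul _ _).symm))
    exact ((S.LD k).isQuotientBy n).bijective_cohomologyMap_of_ker_eq_bot hker |>.1
      (h2.trans (map_zero _).symm)
  · intro h0
    apply hsub
    rw [S.map_subtype_κ_eq_kappaR_tmul κ pins k hker hn, h0, map_zero, map_zero, TensorProduct.zero_tmul]

end Spec

end DVRSetting

end Literature.NumberTheory.GaloisCohomology.Howard2004

end
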